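import Mathlib.LinearAlgebra.Dual.Lemmas
import Mathlib.Algebra.Field.ZMod
import Mathlib.Algebra.BigOperators.Pi
import Mathlib.Tactic.LinearCombination
import HarnessLib

/-!
# Crux `Capture` (stmt-PneNP-2659), line `csp-spine-meet-to-join` rev 4 — three `𝔽₂` linear-algebra
# facts for the span form of Theorem A (`span_prep_lemmas`)

(1) relations true at a pseudo-vector stay true on their span; (2) duality: if `(0,1)` is not in the span
of a set of affine relations then some pseudo-vector satisfies all of them; (3) separation: a point outside
a nonempty affine subset of `𝔽₂^ι` is cut off by an affine form vanishing on the subset. Mathlib only;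
consumed as hypotheses by `twoStep_unsat_iff_span`. Continuation lead c1, 2026-08-16. [folklore]
-/

namespace Summit.PneNP.PneNP.Cruxes.Capture.CspSpineMeetToJoin

set_option linter.dupNamespace false -- `Summit.PneNP.PneNP.…`: summit = sub-problem (D-0017)

/-- **Span preparation lemmas** (registered sub-goal `span_prep_lemmas`): span closure of true
relations, duality for `(0,1) ∉ span`, affine separation — all over `ZMod 2`. [folklore] -/
theorem span_prep_lemmas :
    (∀ (Idx : Type) [Fintype Idx] (Y : Idx → ZMod 2) (S : Set ((Idx → ZMod 2) × ZMod 2)),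
      (∀ wb ∈ S, ∑ i, wb.1 i * Y i = wb.2) →
      ∀ wb ∈ Submodule.span (ZMod 2) S, ∑ i, wb.1 i * Y i = wb.2) ∧
    (∀ (Idx : Type) [Fintype Idx] (S : Set ((Idx → ZMod 2) × ZMod 2)),
      ((0 : Idx → ZMod 2), (1 : ZMod 2)) ∉ Submodule.span (ZMod 2) S →
      ∃ Y : Idx → ZMod 2, ∀ wb ∈ S, ∑ i, wb.1 i * Y i = wb.2) ∧
    (∀ (ι : Type) [Fintype ι] (A' : Set (ι → ZMod 2)), A'.Nonempty →
      (∀ u ∈ A', ∀ u' ∈ A', ∀ u'' ∈ A', u + u' + u'' ∈ A') → ∀ a ∉ A',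
      ∃ e : ZMod 2 × (ι → ZMod 2), (∀ u ∈ A', e.1 + ∑ i, e.2 i * u i = 0) ∧ e.1 + ∑ i, e.2 i * a i ≠ 0) := by
  have zmod2 : ∀ t : ZMod 2, t = 0 ∨ t = 1 := by decide
  have dbl : ∀ t : ZMod 2, t + t = 0 := by decide
  haveI : Fact (Nat.Prime 2) := ⟨Nat.prime_two⟩
  have holds_span : ∀ (Idx : Type) [Fintype Idx] (Y : Idx → ZMod 2) (S : Set ((Idx → ZMod 2) × ZMod 2)),
      (∀ wb ∈ S, ∑ i, wb.1 i * Y i = wb.2) →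
      ∀ wb ∈ Submodule.span (ZMod 2) S, ∑ i, wb.1 i * Y i = wb.2 := by
    intro Idx _ Y S hS wb hwb
    let L : ((Idx → ZMod 2) × ZMod 2) →ₗ[ZMod 2] ZMod 2 :=
      { toFun := fun wb => ∑ i, wb.1 i * Y i + wb.2
        map_add' := fun a b => by
          simp only [Prod.fst_add, Prod.snd_add, Pi.add_apply, add_mul, Finset.sum_add_distrib]; abel
        map_smul' := fun t a => by
          simp only [Prod.smul_fst, Prod.smul_snd, Pi.smul_apply, smul_eq_mul, RingHom.id_apply,
            Finset.mul_sum, mul_add, mul_assoc] }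
    have hker : S ⊆ (LinearMap.ker L : Set _) := fun wb h => by
      simp only [SetLike.mem_coe, LinearMap.mem_ker, L, LinearMap.coe_mk, AddHom.coe_mk, hS wb h, dbl]
    have := (Submodule.span_le.2 hker) hwb
    simp only [LinearMap.mem_ker, L, LinearMap.coe_mk, AddHom.coe_mk] at this
    calc ∑ i, wb.1 i * Y i = ∑ i, wb.1 i * Y i + wb.2 + wb.2 := by rw [add_assoc, dbl, add_zero]
      _ = wb.2 := by rw [this, zero_add]
  refine ⟨holds_span, ?_, ?_⟩
  · intro Idx _ S hsp
    classical
    set M := Submodule.span (ZMod 2) S with hM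
    haveI : Module.Free (ZMod 2) (((Idx → ZMod 2) × ZMod 2) ⧸ M) := Module.Free.of_divisionRing (ZMod 2) _
    obtain ⟨f, hf0, hfM⟩ := Submodule.exists_dual_map_eq_bot_of_notMem hsp Module.Projective.of_free
    have hfM' : ∀ wb ∈ M, f wb = 0 := fun wb h => by
      have : f wb ∈ M.map f := Submodule.mem_map_of_mem h
      rwa [hfM, Submodule.mem_bot] at this
    have hf1 : f ((0 : Idx → ZMod 2), (1 : ZMod 2)) = 1 := (zmod2 _).resolve_left hf0
    refine ⟨fun i => f (Pi.single i 1, 0), fun wb hwb => ?_⟩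
    have hsplit : wb = ((wb.1, (0 : ZMod 2)) : (Idx → ZMod 2) × ZMod 2) + wb.2 • ((0 : Idx → ZMod 2), 1) := by
      ext i <;> simp
    have hg : f (wb.1, 0) = ∑ i, wb.1 i * f (Pi.single i 1, 0) := by
      have h1 := LinearMap.pi_apply_eq_sum_univ (f ∘ₗ LinearMap.inl (ZMod 2) (Idx → ZMod 2) (ZMod 2)) wb.1
      have h2 : ∀ i : Idx, (fun j => if i = j then (1 : ZMod 2) else 0) = Pi.single i 1 := fun i => by
        funext j; simp [Pi.single_apply, eq_comm]
      simp only [LinearMap.coe_comp, Function.comp_apply, LinearMap.inl_apply, h2, smul_eq_mul] at h1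
      exact h1
    have h0 : f wb = 0 := hfM' wb (Submodule.subset_span hwb)
    rw [hsplit, map_add, map_smul, hf1, hg, smul_eq_mul, mul_one] at h0
    calc ∑ i, wb.1 i * f (Pi.single i 1, 0) = ∑ i, wb.1 i * f (Pi.single i 1, 0) + wb.2 + wb.2 := by
          rw [add_assoc, dbl, add_zero]
      _ = wb.2 := by rw [h0, zero_add]
  · intro ι _ A' ⟨u₀, hu₀⟩ h3 a ha
    classical
    let W : Submodule (ZMod 2) (ι → ZMod 2) :=
      { carrier := {d | u₀ + d ∈ A'}
        zero_mem' := by simpa using hu₀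
        add_mem' := fun {d d'} hd hd' => by
          have := h3 _ hd _ hu₀ _ hd'
          have e : u₀ + d + u₀ + (u₀ + d') = u₀ + (d + d') := by
            funext i; simp only [Pi.add_apply]; linear_combination dbl (u₀ i)
          show u₀ + (d + d') ∈ A'
          rwa [e] at this
        smul_mem' := fun t d hd => by
          rcases zmod2 t with rfl | rfl
          · simpa using hu₀
          · simpa using hd }
    have hW : a - u₀ ∉ W := fun h => ha (by simpa using (show u₀ + (a - u₀) ∈ A' from h))
    haveI : Module.Free (ZMod 2) (_ ⧸ W) := Module.Free.of_divisionRing (ZMod 2) _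
    obtain ⟨φ, hφ0, hφW⟩ := Submodule.exists_dual_map_eq_bot_of_notMem hW Module.Projective.of_free
    have hφW' : ∀ d ∈ W, φ d = 0 := fun d hd => by
      have : φ d ∈ W.map φ := Submodule.mem_map_of_mem hd
      rwa [hφW, Submodule.mem_bot] at this
    have hφsum : ∀ u, φ u = ∑ i, φ (Pi.single i 1) * u i := fun u => by
      have h1 := LinearMap.pi_apply_eq_sum_univ φ u
      have h2 : ∀ i : ι, (fun j => if i = j then (1 : ZMod 2) else 0) = Pi.single i 1 :=
        fun i => by funext j; simp [Pi.single_apply, eq_comm]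
      rw [h1]; exact Finset.sum_congr rfl fun i _ => by rw [h2, smul_eq_mul, mul_comm]
    refine ⟨(φ u₀, fun i => φ (Pi.single i 1)), fun u hu => ?_, ?_⟩
    · show φ u₀ + ∑ i, φ (Pi.single i 1) * u i = 0
      rw [← hφsum, ← map_add]
      have : u₀ + u = u - u₀ := by
        funext i; simp only [Pi.add_apply, Pi.sub_apply]; rw [sub_eq_add_neg, ZMod.neg_eq_self_mod_two, add_comm]
      rw [this]; exact hφW' _ (by show u₀ + (u - u₀) ∈ A'; simpa using hu)
    · show φ u₀ + ∑ i, φ (Pi.single i 1) * a i ≠ 0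
      rw [← hφsum, ← map_add]
      have : u₀ + a = a - u₀ := by
        funext i; simp only [Pi.add_apply, Pi.sub_apply]; rw [sub_eq_add_neg, ZMod.neg_eq_self_mod_two, add_comm]
      rwa [this]

end Summit.PneNP.PneNP.Cruxes.Capture.CspSpineMeetToJoin
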